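import Mathlib
import Summits.Ventures.PercRepro.TriangleCapRowTCapArith

/-!
# PercRepro — THE CAP ON THE ROW `a = 4` AT `r = 4 + j`: the arithmetic (p3, gen 49; part 205a)

The joint accounting of part 202a (`capGen_N_sum`) and the `M = 1` arithmetic of part 203e (`capTreg_sq_arith`)
with `4 ≤ a` in place of `5 ≤ a` (the proofs verbatim), the crude `M ≥ 2` accounting at `a = 4`, and the no-edge
count inside the three non-neighbours for `K ≥ 9 + j`, and at the corner `K = 8 + j` through the three pair
constraints of the forced triangle `R`. Axioms: standard.
-/

namespace PercRepro

namespace TriangleCap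

namespace C047

open Finset

variable {V : Type*} [DecidableEq V] [Fintype V]

/-- **THE ARITHMETIC OF `M = 1` AGAINST THE ONE-TRIANGLE TARGET** (`δ = j + 2`, every `a ≥ 5`, `n₊ ≤ a − 1`):
`K² + S_N + S_R + (a + j)(k − 1 − (a + j)) + (2k − 14 + 2j (a − 3)) ≤ m k`, `k = K + a`; slack EXACTLY `0`. -/
theorem capFour_sq_arith (a j K P SN SR np m : ℕ) (ha : 4 ≤ a) (hnR : np + 1 ≤ a) (hK : 2 * a + j ≤ K)
    (hm : m + (a + j) = a * K) (hP : P + (a + j + 1) + K = a * K)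
    (hSN : SN + (j + 2) * (a - 1 - np) ≤ K + 6 + (a + 1) * P + 2 * (a - 1))
    (hSR : SR + 2 * (j + 2) * (K - 1) + (j + 2) * np ≤ (a - 1) * ((K - 1) * (K - 1)) + (j + 2) * (j + 3)) :
    K * K + SN + SR + (a + j) * (K + a - 1 - (a + j)) + (2 * (K + a) - 14 + 2 * j * (a - 3)) ≤ m * (K + a) := by
  have h1 : np ≤ a - 1 := by omega
  have h2 : 1 ≤ a := by omega
  have h3 : 1 ≤ K := by omega
  have h4 : a + j ≤ K + a - 1 := by omega
  have h5 : 1 ≤ K + a := by omega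
  have h6 : 14 ≤ 2 * (K + a) := by omega
  have h7 : 3 ≤ a := by omega
  zify [h1, h2, h3, h4, h5, h6, h7] at hSN hSR hm hP ⊢
  have hmZ : (m : ℤ) = a * K - (a + j) := by linarith
  have hPZ : (P : ℤ) = a * K - (a + j + 1) - K := by linarith
  rw [hmZ]
  rw [hPZ] at hSN
  nlinarith [hSN, hSR]

/-- **THE `N`-SUM AT `M = 1` AND DEFICIT `δ`** (`|R| = a − 1`): with `d(y) = 1 + f(y) + g(y)`, `f ≤ 1`, `Σ_N f = 2`,
`Σ_N g = P`, `2 Σ_N fg ≤ 2 (a − 1)`, `P + (a + δ − 1) + K = aK` (the `a + δ − 1` misses), `|N| = K`, every non-end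
missed by at most `n₊` vertices of `R` and the two ends missed `≤ (a − 1) + n₊` times in all:
`Σ_N d² + δ (a − 1 − n₊) ≤ K + 6 + (a + 1) P + 2 (a − 1)`. -/
theorem capGen_N_sum_four (D : SimpleGraph V) [DecidableRel D.Adj] (N R : Finset V) (K a P np δ : ℕ)
    (ha : 4 ≤ a) (hKdef : N.card = K) (hRcard : R.card + 1 = a)
    (hdegN : ∀ y ∈ N, deg D y = 1 + degIn D N y + degIn D R y) (hf1 : ∀ y ∈ N, degIn D N y ≤ 1)
    (hTf : ∑ y ∈ N, degIn D N y = 2) (hPdef : ∑ y ∈ N, degIn D R y = P)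
    (hfg_le : 2 * ∑ y ∈ N, degIn D N y * degIn D R y ≤ 2 * (a - 1))
    (hP : P + (a + δ - 1) + K = a * K)
    (hNE : ∀ y ∈ N, degIn D N y = 0 → a - 1 - degIn D R y ≤ np)
    (hE2 : ∀ y₁ ∈ N, ∀ y₂ ∈ N, y₁ ≠ y₂ → degIn D N y₁ = 1 → degIn D N y₂ = 1 →
      (a - 1 - degIn D R y₁) + (a - 1 - degIn D R y₂) ≤ (a - 1) + np) :
    ∑ y ∈ N, deg D y * deg D y + δ * (a - 1 - np) ≤ K + 6 + (a + 1) * P + 2 * (a - 1) := by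
  have hg : ∀ y ∈ N, degIn D R y + 1 ≤ a := fun y _ => by
    have := degIn_le_card D R y
    omega
  have hid : ∀ y ∈ N, deg D y * deg D y + degIn D R y * (a - 1 - degIn D R y) =
      1 + 3 * degIn D N y + (a + 1) * degIn D R y + 2 * (degIn D N y * degIn D R y) := fun y hy => by
    rw [hdegN y hy]
    exact rowA_vertex_identity _ _ _ (hf1 y hy) (hg y hy)
  have hsumid : ∑ y ∈ N, deg D y * deg D y + ∑ y ∈ N, degIn D R y * (a - 1 - degIn D R y) =
      K + 3 * 2 + (a + 1) * P + 2 * ∑ y ∈ N, degIn D N y * degIn D R y := by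
    rw [← sum_add_distrib, sum_congr rfl hid, sum_add_distrib, sum_add_distrib, sum_add_distrib, sum_const,
      smul_eq_mul, mul_one, ← mul_sum, ← mul_sum, ← mul_sum, hKdef, hTf, hPdef]
  obtain ⟨S₀, hS₀⟩ : ∃ S₀ : Finset V, S₀ = N.filter (fun y => degIn D N y = 0) := ⟨_, rfl⟩
  obtain ⟨S₁, hS₁⟩ : ∃ S₁ : Finset V, S₁ = N.filter (fun y => ¬ degIn D N y = 0) := ⟨_, rfl⟩
  have hS₁card : S₁.card = 2 := by
    have h : ∑ y ∈ N, degIn D N y = ∑ y ∈ S₁, 1 := by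
      rw [hS₁, sum_filter]
      apply sum_congr rfl
      intro y hy
      have := hf1 y hy
      split_ifs with h <;> omega
    rw [hTf, sum_const, smul_eq_mul, mul_one] at h
    exact h.symm
  have hS₀card : S₀.card + 2 = K := by
    have := card_filter_add_card_filter_not (s := N) (fun y => degIn D N y = 0)
    rw [← hS₀, ← hS₁, hS₁card, hKdef] at this
    exact this
  have hfg : ∑ y ∈ N, degIn D N y * degIn D R y = ∑ y ∈ S₁, degIn D R y := by
    rw [hS₁, sum_filter]
    apply sum_congr rfl
    intro y hy
    have := hf1 y hy
    by_cases h : degIn D N y = 0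
    · rw [if_neg (fun h' => h' h), h, zero_mul]
    · have h1 : degIn D N y = 1 := by omega
      rw [h1, if_pos (by omega), one_mul]
  have hgsplit : ∑ y ∈ N, degIn D R y = ∑ y ∈ S₀, degIn D R y + ∑ y ∈ S₁, degIn D R y := by
    rw [hS₀, hS₁, sum_filter_add_sum_filter_not]
  have hLsplit : ∑ y ∈ N, degIn D R y * (a - 1 - degIn D R y) =
      ∑ y ∈ S₀, degIn D R y * (a - 1 - degIn D R y) + ∑ y ∈ S₁, degIn D R y * (a - 1 - degIn D R y) := by
    rw [hS₀, hS₁, sum_filter_add_sum_filter_not]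
  have hmiss : ∑ y ∈ S₀, (a - 1 - degIn D R y) + ∑ y ∈ S₀, degIn D R y = S₀.card * (a - 1) := by
    rw [← sum_add_distrib]
    have h : ∀ y ∈ S₀, (a - 1 - degIn D R y) + degIn D R y = a - 1 := fun y hy => by
      have := hg y (mem_of_mem_filter y (hS₀ ▸ hy))
      omega
    rw [sum_congr rfl h, sum_const, smul_eq_mul]
  obtain ⟨y₁, y₂, hne, hS₁eq⟩ := card_eq_two.mp hS₁card
  have hy₁S₁ : y₁ ∈ S₁ := by
    rw [hS₁eq]
    exact mem_insert_self _ _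
  have hy₂S₁ : y₂ ∈ S₁ := by
    rw [hS₁eq]
    exact mem_insert_of_mem (mem_singleton_self _)
  have hy₁N : y₁ ∈ N := by
    rw [hS₁] at hy₁S₁
    exact mem_of_mem_filter _ hy₁S₁
  have hy₂N : y₂ ∈ N := by
    rw [hS₁] at hy₂S₁
    exact mem_of_mem_filter _ hy₂S₁
  have hf₁ : degIn D N y₁ = 1 := by
    have h := hy₁S₁
    rw [hS₁, mem_filter] at h
    have := hf1 y₁ hy₁N
    omega
  have hf₂ : degIn D N y₂ = 1 := by
    have h := hy₂S₁
    rw [hS₁, mem_filter] at h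
    have := hf1 y₂ hy₂N
    omega
  have hS₁g : ∑ y ∈ S₁, degIn D R y = degIn D R y₁ + degIn D R y₂ := by rw [hS₁eq, sum_pair hne]
  have hS₁L : ∑ y ∈ S₁, degIn D R y * (a - 1 - degIn D R y) =
      degIn D R y₁ * (a - 1 - degIn D R y₁) + degIn D R y₂ * (a - 1 - degIn D R y₂) := by
    rw [hS₁eq, sum_pair hne]
  have hg₁ := hg y₁ hy₁N
  have hg₂ := hg y₂ hy₂N
  have hmiss2 : ∑ y ∈ S₀, (a - 1 - degIn D R y) + (a - 1 - degIn D R y₁ - degIn D R y₂) = δ := by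
    obtain ⟨K', hK'⟩ : ∃ K', K = K' + 2 := ⟨K - 2, by omega⟩
    have hS₀' : S₀.card = K' := by omega
    rw [hS₀'] at hmiss
    rw [hK'] at hP
    rw [hfg, hS₁g] at hfg_le
    rw [hgsplit, hS₁g] at hPdef
    have e1 : K' * (a - 1) + K' = K' * a := by
      rw [← Nat.mul_succ]
      congr 1
      omega
    have e2 : a * (K' + 2) = K' * a + 2 * a := by ring
    omega
  -- the non-ends: each missed at most `np` times, the loss `(a − 1 − np)` per miss
  have hloss : (a - 1 - np) * ∑ y ∈ S₀, (a - 1 - degIn D R y) ≤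
      ∑ y ∈ S₀, degIn D R y * (a - 1 - degIn D R y) := by
    rw [mul_sum]
    apply sum_le_sum
    intro y hy
    have hyN : y ∈ N := mem_of_mem_filter y (hS₀ ▸ hy)
    have hy0 : degIn D N y = 0 := by
      have h := hy
      rw [hS₀, mem_filter] at h
      exact h.2
    have hle : a - 1 - degIn D R y ≤ np := hNE y hyN hy0
    have := hg y hyN
    exact Nat.mul_le_mul_right _ (by omega)
  -- the two ends
  have hfg_le' : degIn D R y₁ + degIn D R y₂ ≤ a - 1 := by
    rw [hfg, hS₁g] at hfg_le
    omega
  obtain ⟨e, he⟩ : ∃ e, (a - 1 - degIn D R y₁) + (a - 1 - degIn D R y₂) = a - 1 + e :=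
    ⟨(a - 1 - degIn D R y₁) + (a - 1 - degIn D R y₂) - (a - 1), by omega⟩
  have hen : e ≤ np := by
    have := hE2 y₁ hy₁N y₂ hy₂N hne hf₁ hf₂
    omega
  have hends := rowA1_ends_loss_ref (a - 1 - degIn D R y₁) (a - 1 - degIn D R y₂) e a (by omega) (by omega) he
  have eg₁ : a - 1 - (a - 1 - degIn D R y₁) = degIn D R y₁ := by omega
  have eg₂ : a - 1 - (a - 1 - degIn D R y₂) = degIn D R y₂ := by omega
  rw [eg₁, eg₂] at hends
  have hends' : e * (a - 1 - np) ≤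
      degIn D R y₁ * (a - 1 - degIn D R y₁) + degIn D R y₂ * (a - 1 - degIn D R y₂) := by
    have h1 : (a - 1 - degIn D R y₁) * degIn D R y₁ = degIn D R y₁ * (a - 1 - degIn D R y₁) := mul_comm _ _
    have h2 : (a - 1 - degIn D R y₂) * degIn D R y₂ = degIn D R y₂ * (a - 1 - degIn D R y₂) := mul_comm _ _
    rw [h1, h2] at hends
    have h3 : e * (a - 1 - np) ≤ e * (a - 1 - e) := Nat.mul_le_mul_left _ (by omega)
    omega
  have hsum3 : ∑ y ∈ S₀, (a - 1 - degIn D R y) + e = δ := by omega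
  have hL : δ * (a - 1 - np) ≤ ∑ y ∈ N, degIn D R y * (a - 1 - degIn D R y) := by
    rw [hLsplit, hS₁L]
    have h3 : δ * (a - 1 - np) = (a - 1 - np) * ∑ y ∈ S₀, (a - 1 - degIn D R y) + e * (a - 1 - np) := by
      rw [← hsum3]
      ring
    omega
  rw [hfg, hS₁g] at hsumid
  omega

/-- **THE ARITHMETIC OF `M ≥ 2` ON THE ROW `a = 4`:** `K ≥ 9 + j`, `m + (4 + j) = 4K`, `P + (4 + j + M) + K = 4K`,
`2M + δ = 4 + j`, `S_N ≤ K + 6M + 5P + 6M`, `S_R + 2δ (K − M) ≤ 3 (K − M)² + δ²` ⇒ the one-triangle target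
`2k − 14 + 2j` on `(k, 4, 4 + j)`, `k = K + 4`; slack `≥ 4` (`K ≥ 8 + j`: the corner included). -/
theorem capFour_sq_arith_M2 (j K M P SN SR δ m : ℕ) (hM : 2 ≤ M) (hK : 8 + j ≤ K)
    (hm : m + (4 + j) = 4 * K) (hP : P + (4 + j + M) + K = 4 * K) (hδ : 2 * M + δ = 4 + j)
    (hSN : SN ≤ K + 6 * M + 5 * P + 2 * M * 3)
    (hSR : SR + 2 * δ * (K - M) ≤ 3 * ((K - M) * (K - M)) + δ * δ) :
    K * K + SN + SR + (4 + j) * (K + 4 - 1 - (4 + j)) + (2 * (K + 4) - 14 + 2 * j * (4 - 3)) ≤ m * (K + 4) := by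
  obtain ⟨M2, rfl⟩ : ∃ M2, M = M2 + 2 := ⟨M - 2, by omega⟩
  have hj : j = δ + 2 * M2 := by omega
  subst hj
  obtain ⟨t, rfl⟩ : ∃ t, K = 8 + (δ + 2 * M2) + t := ⟨K - (8 + (δ + 2 * M2)), by omega⟩
  have h2 : M2 + 2 ≤ 8 + (δ + 2 * M2) + t := by omega
  have h3 : 4 + (δ + 2 * M2) ≤ 8 + (δ + 2 * M2) + t + 4 - 1 := by omega
  have h4 : 1 ≤ 8 + (δ + 2 * M2) + t + 4 := by omega
  have h5 : 14 ≤ 2 * (8 + (δ + 2 * M2) + t + 4) := by omega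
  zify [h2, h3, h4, h5] at hSN hSR hm hP ⊢
  have hmZ : (m : ℤ) = 4 * (8 + (δ + 2 * M2) + t) - (4 + (δ + 2 * M2)) := by linarith
  have hPZ : (P : ℤ) = 4 * (8 + (δ + 2 * M2) + t) - (4 + (δ + 2 * M2) + (M2 + 2)) - (8 + (δ + 2 * M2) + t) := by
    linarith
  rw [hmZ]
  rw [hPZ] at hSN
  nlinarith [hSN, hSR, Nat.zero_le (M2 * M2), Nat.zero_le (δ * M2), Nat.zero_le (M2 * t), Nat.zero_le (δ * t),
    Nat.zero_le (δ * δ)]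

/-- **NO EDGE INSIDE THE THREE NON-NEIGHBOURS ON THE ROW `a = 4` FOR `K ≥ 9 + j`:** the degree count with an edge
`u v` inside `R` (`P_u + P_v ≤ K + 1`, the third vertex at `≤ K − M`, `P + E ≤ 3K`, `d_R ≤ 2`). -/
theorem capFour_noedge (j K M P E m Pu Pv Pr du dv dr : ℕ) (hK : 9 + j ≤ K)
    (hdeg : K + (K + 2 * M + P) + (P + E) = 2 * m) (hm : m + (4 + j) = 4 * K)
    (h1 : P + E ≤ 3 * K) (hPuv : Pu + Pv ≤ K + 1) (hrest : Pr + M ≤ K)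
    (hP : P = Pu + Pv + Pr) (hE : E = du + dv + dr) (hdu : du ≤ 2) (hdv : dv ≤ 2) (hdr : dr ≤ 2)
    (hdu1 : 1 ≤ du) : False := by
  subst hP hE
  omega

/-- **THE CORNER `K = 8 + j`:** with an edge `u v` inside the three non-neighbours the counts force `E = 6` (`R` is a
triangle: `E ≥ 2K − 10 − 2j = 6`), and then every `y ∈ N` is adjacent to at most two of `R` with at most three
`y`'s adjacent to two (`K₄⁻`: each pair of `R` has at most one common neighbour), `P ≤ K + 3`; with
`P = 2K + 1 − M` and `2M ≤ K − 1` this is impossible. -/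
theorem capFour_noedge_corner (j K M P E m Pu Pv Pw du dv dw : ℕ) (hK : K = 8 + j)
    (hdeg : K + (K + 2 * M + P) + (P + E) = 2 * m) (hm : m + (4 + j) = 4 * K)
    (h2 : P + 3 * M ≤ 3 * K) (hPuv : Pu + Pv ≤ K + 1) (hPw : Pw + M ≤ K)
    (hP : P = Pu + Pv + Pw) (hE : E = du + dv + dw) (hdu : du ≤ 2) (hdv : dv ≤ 2) (hdw : dw ≤ 2)
    (hP3 : dw = 2 → P ≤ K + 3) : False := by
  subst hP hE hK
  have hdw2 : dw = 2 := by omega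
  have := hP3 hdw2
  omega

end C047

end TriangleCap

end PercRepro
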